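import Summits.AnomalousDissipation.AnomalousDissipation.Theorems.ScalarAnomalySteadySourceFormal.Negative.ShearTotal
import Summits.AnomalousDissipation.AnomalousDissipation.Theorems.ScalarAnomalySteadySourceFormal.Negative.ShearHonest

/-!
# Negative knowledge for the crux `ScalarAnomalySteadySourceFormal` (stmt-AnomalousDissipation-0448), VII-h:
# NO-GO — shear–drift (band-limited parallel shear + uniform drift) stirring carries no scalar anomaly

Certified copy of §9.8 of the cdisprove work file, the assembly.  **Theorem**
(`shearDrift_not_anomalous`): let the velocity fields of a family be real trigonometric polynomials
`u_j(t) = realTrigPoly S (c_j t)` on a fixed finite set of modes `S ⊆ {k : k 1 = 0, |k 0| ≤ R}`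
(parallel shear flows `x ↦ (m₀(t), m₁(t) + W_j(t, x₀))` with band-limited profiles and an arbitrary
uniform drift), with continuous coefficient paths bounded by `M` uniformly in `j` and transversal
(`k · c_j(t,k) = 0`, each mode divergence free); let `h` be ONE smooth mean-zero source, `ν_j → 0`,
`θ_{0,j} ∈ L²` ARBITRARY data and `θ_j` ARBITRARY global weak solutions of the crux's forced class.
If `⟨‖θ_j‖²⟩ ≤ E` for all `j`, then `inf_j ⟨ν_j ‖∇θ_j‖²⟩ = 0`: no anomaly.

This covers (and vastly extends) the rest flow (§6) and constant drifts (§8): the Galilean-swept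
Marchioro states `Literature.Barriers.AnomalousDissipation.marchioroSweptState` (all momenta, all
transients — the family that settles crux #3 `TwodBoundedEnergy` "true for the wrong reason"),
Kolmogorov flows and every Galerkin truncation of a parallel shear flow.  Mechanism: the shear
couples a scalar mode only to its `x₀`-neighbours inside its own sector `p 1 = const`, so the
spectral flux through `|p 0| = K` in the sectors `|p 1| ≤ K₂` is `≲ K₂ · (energy near the layer)`
— NOT `K ·` — and a pigeonhole over `K ≤ K₁ ~ ν^{-1/2}` makes it `O(K₂/K₁)`; with Poincaré-honest
variance means this caps the dissipation means below any `ε` (rate `ν^{1/3}`-type, the critical-layer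
scaling).  Proof entirely at the level of the modal ODEs of weak solutions (no uniqueness, no
regularity beyond `L^∞_t L²_x`).  Corollaries: `not_cruxShearDrift` (existential form),
`not_anomalous_of_isCandidate_shearDrift` (clause bundle of `Negative.KillShape`).

Supports stmt-AnomalousDissipation-0448.
-/

set_option linter.dupNamespace false

noncomputable section

open scoped BigOperators Topology ENNReal NNReal InnerProductSpace ContDiff
open Filter Set Function MeasureTheory UnitAddTorus Complex

namespace Summit.AnomalousDissipation.AnomalousDissipation.Theorems.ScalarAnomalySteadySourceFormal.Negative

open Literature.Analysis
open Literature.Analysis.FunctionSpaces Literature.Analysis.FunctionSpaces.Torus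
open Literature.Analysis.FluidPDE Literature.Analysis.FluidPDE.Torus

/-- The frequency lattice `ℤ²` (local notation). -/
local notation "ℤ²" => Fin 2 → ℤ

section Tail

variable {h : UnitAddTorus (Fin 2) → ℝ}

/-- The tail mass is monotone in the first box size. [folklore] -/
theorem sourceTailMass_mono (hh : MemLp h 2 volume) {K K' K₂ : ℤ} (hK : K ≤ K') :
    sourceTailMass K' K₂ h ≤ sourceTailMass K K₂ h := by
  classical
  unfold sourceTailMass
  refine Real.sqrt_le_sqrt ?_
  have hsumm : ∀ L : ℤ, Summable fun p : ℤ² => if p ∈ box L K₂ then (0 : ℝ) else ‖mFourierCoeff (fun x => (h x : ℂ)) p‖ ^ 2 := by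
    intro L
    refine Summable.of_nonneg_of_le (fun p => by split_ifs <;> positivity) (fun p => ?_)
      (FunctionSpaces.Torus.hasSum_sq_norm_mFourierCoeff_ofReal hh).summable
    split_ifs
    exacts [sq_nonneg _, le_rfl]
  refine Summable.tsum_le_tsum (fun p => ?_) (hsumm K') (hsumm K)
  by_cases hp : p ∈ box K K₂
  · have hp' : p ∈ box K' K₂ := by
      rw [mem_box] at hp ⊢; exact ⟨hp.1.trans hK, hp.2⟩
    rw [if_pos hp, if_pos hp']
  · rw [if_neg hp]
    split_ifs
    exacts [sq_nonneg _, le_rfl]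

/-- **The tail mass vanishes**: for `h ∈ L²` and `η > 0` there is `L` with `η_out(L,L) ≤ η`. [folklore] -/
theorem sourceTailMass_small (hh : MemLp h 2 volume) {η : ℝ} (hη : 0 < η) :
    ∃ L : ℕ, sourceTailMass L L h ≤ η := by
  classical
  have hpar := FunctionSpaces.Torus.hasSum_sq_norm_mFourierCoeff_ofReal hh
  set N2 : ℤ² → ℝ := fun p => ‖mFourierCoeff (fun x => (h x : ℂ)) p‖ ^ 2 with hN2
  have htend := tendsto_tsum_compl_atTop_zero N2
  have hη2 : 0 < η ^ 2 := by positivity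
  obtain ⟨F, hF⟩ := eventually_atTop.1 (htend.eventually (Iio_mem_nhds hη2))
  have hF' : ∑' p : {x // x ∉ F}, N2 p < η ^ 2 := hF F le_rfl
  obtain ⟨L, hL⟩ : ∃ L : ℕ, ∀ p ∈ F, |p 0| ≤ L ∧ |p 1| ≤ L := by
    refine ⟨F.sup fun p => (|p 0|).toNat + (|p 1|).toNat, fun p hp => ?_⟩
    have h1 : (|p 0|).toNat + (|p 1|).toNat ≤ F.sup fun p => (|p 0|).toNat + (|p 1|).toNat :=
      Finset.le_sup (f := fun p : ℤ² => (|p 0|).toNat + (|p 1|).toNat) hp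
    constructor <;> omega
  refine ⟨L, ?_⟩
  have hFbox : ∀ p, p ∉ box (L : ℤ) L → p ∉ F := fun p hp hpF => hp (mem_box.2 (hL p hpF))
  have hsumm : Summable fun p : ℤ² => if p ∈ box (L : ℤ) L then (0 : ℝ) else N2 p := by
    refine Summable.of_nonneg_of_le (fun p => by split_ifs <;> positivity) (fun p => ?_) hpar.summable
    split_ifs
    exacts [sq_nonneg _, le_rfl]
  have hle : (∑' p : ℤ², if p ∈ box (L : ℤ) L then (0 : ℝ) else N2 p) ≤ ∑' p, ((↑F : Set ℤ²)ᶜ).indicator N2 p := by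
    refine Summable.tsum_le_tsum (fun p => ?_) hsumm (hpar.summable.indicator _)
    split_ifs with hp
    · exact Set.indicator_nonneg (fun _ _ => by positivity) _
    · rw [Set.indicator_of_mem (by simpa using hFbox p hp)]
  rw [← tsum_subtype] at hle
  unfold sourceTailMass
  calc Real.sqrt (∑' p : ℤ², if p ∈ box (L : ℤ) L then (0 : ℝ) else ‖mFourierCoeff (fun x => (h x : ℂ)) p‖ ^ 2)
      ≤ Real.sqrt (η ^ 2) := Real.sqrt_le_sqrt (hle.trans hF'.le)
    _ = η := Real.sqrt_sq hη.le

end Tail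

section NoGo

variable {S : Finset ℤ²} {R : ℕ} {M : ℝ} {h : UnitAddTorus (Fin 2) → ℝ}

/-- **Per-`T` estimate of the dissipation MEAN** of one shear–drift-stirred solution, with the
inner-layer pigeonhole performed: for `T > 0`, `L ≥ 0`, `N ≥ 1`,
`⟨ν‖∇θ‖²⟩_T ≤ ‖θ₀‖²/(2T) + (4π²ν((L+N)²+L²) + 4πR·#S·M·L/N + η₀/2)·⟨‖θ‖²⟩_T + η₀/2`,
`η₀ = η_out(L,L)`. [folklore] -/
theorem timeMean_diss_le {ν : ℝ} (hν : 0 < ν) {c : ℝ → ℤ² → EuclideanSpace ℂ (Fin 2)}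
    {u : ℝ → UnitAddTorus (Fin 2) → EuclideanSpace ℝ (Fin 2)} {θ₀ : UnitAddTorus (Fin 2) → ℝ}
    {θ : ℝ → UnitAddTorus (Fin 2) → ℝ} (hw : IsWeakScalarTransportForced ν u (fun _ => h) θ₀ θ)
    (hu : ∀ s, u s = realTrigPoly S (c s)) (hh : MemLp h 2 volume) (hθ₀ : MemLp θ₀ 2 volume)
    (hc : ∀ k, Continuous fun s => c s k) (hM : ∀ s k, ‖c s k‖ ≤ M) (hM0 : 0 ≤ M)
    (htrans : ∀ s, ∀ k ∈ S, zdot k (c s k) = 0) (hS : ∀ k ∈ S, k 1 = 0 ∧ |k 0| ≤ R)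
    (L : ℕ) {N : ℕ} (hN : 1 ≤ N) {T : ℝ} (hT : 0 < T) :
    timeMean (fun t => ν * (eScalarGradNormSq (θ t)).toReal) T ≤
      scalarL2Sq θ₀ / (2 * T) +
        (4 * Real.pi ^ 2 * ν * (((L : ℝ) + N) ^ 2 + (L : ℝ) ^ 2) + 4 * Real.pi * R * S.card * M * L / N +
          sourceTailMass L L h / 2) * timeMean (fun t => scalarL2Sq (θ t)) T +
        sourceTailMass L L h / 2 := by
  have hwT := hw T hT
  set V : ℝ := ∫ t in Ioo 0 T, scalarL2Sq (θ t) with hV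
  have hV0 : 0 ≤ V := setIntegral_nonneg measurableSet_Ioo fun _ _ => scalarL2Sq_nonneg _
  set η₀ := sourceTailMass L L h with hη₀
  have hη₀0 : 0 ≤ η₀ := sourceTailMass_nonneg _ _ _
  -- inner pigeonhole
  obtain ⟨K, hKI, hK⟩ := exists_layer_small (R := R) hw hT (L : ℤ) (L : ℤ) hN
  rw [Finset.mem_Ico] at hKI
  have hK0 : (0 : ℤ) ≤ K := le_trans (Int.natCast_nonneg L) hKI.1
  -- per-T inequality at (K, L)
  have hper := perT_dissipation_le hw hν.le hu hh hθ₀ hc hM hM0 htrans hS (K := K) (K₂ := L) (Int.natCast_nonneg L) hT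
  set I : ℝ≥0∞ := ∫⁻ t in Ioo 0 T, eScalarGradNormSq (θ t) with hI
  set W : ℝ := ∫ t in Ioo 0 T, Real.sqrt (scalarL2Sq (θ t)) with hW
  set G : ℝ := ∫ t in Ioo 0 T, layerSum (K - R) (K + R) L (modes θ t) with hG
  have hG0 : 0 ≤ G := setIntegral_nonneg measurableSet_Ioo fun _ _ => layerSum_nonneg _ _ _ _
  have hW0 : 0 ≤ W := setIntegral_nonneg measurableSet_Ioo fun _ _ => Real.sqrt_nonneg _
  set B : ℝ := scalarL2Sq θ₀ + 8 * Real.pi ^ 2 * ν * ((K : ℝ) ^ 2 + (L : ℝ) ^ 2) * V +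
    4 * Real.pi * S.card * M * L * G + 2 * sourceTailMass K L h * W with hB
  have hB0 : 0 ≤ B := by
    have := scalarL2Sq_nonneg θ₀; have := sourceTailMass_nonneg K L h; have := Real.pi_pos
    positivity
  have hper' : ENNReal.ofReal (2 * ν) * I ≤ ENNReal.ofReal B := by simpa [hB, hI] using hper
  have hIfin : I ≠ ⊤ := by
    intro htop
    rw [htop, ENNReal.mul_top (by simpa using hν)] at hper'
    exact ENNReal.ofReal_ne_top (top_le_iff.1 hper')
  have hreal : 2 * ν * I.toReal ≤ B := by
    have := ENNReal.toReal_le_of_le_ofReal hB0 hper'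
    rwa [ENNReal.toReal_mul, ENNReal.toReal_ofReal (by positivity)] at this
  -- bounds on the pieces
  have hW' : W ≤ (T + V) / 2 := by
    have hi1 : IntegrableOn (fun _ : ℝ => (1 : ℝ)) (Ioo 0 T) volume := integrableOn_const (hs := measure_Ioo_lt_top.ne)
    have h1 : ∫ t in Ioo 0 T, Real.sqrt (scalarL2Sq (θ t)) ≤ ∫ t in Ioo 0 T, (1 + scalarL2Sq (θ t)) / 2 := by
      refine integral_mono_ae (forced_integrableOn_sqrt_scalarL2Sq hwT)
        ((hi1.add (forced_integrableOn_scalarL2Sq hwT)).div_const _) (Eventually.of_forall fun t => ?_)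
      have h0 := scalarL2Sq_nonneg (θ t)
      nlinarith [Real.sq_sqrt h0, sq_nonneg (Real.sqrt (scalarL2Sq (θ t)) - 1), Real.sqrt_nonneg (scalarL2Sq (θ t))]
    rw [integral_div, integral_add hi1 (forced_integrableOn_scalarL2Sq hwT),
      setIntegral_const, Real.volume_real_Ioo_of_le hT.le, sub_zero, smul_eq_mul, mul_one] at h1
    exact h1
  have hη : sourceTailMass K L h ≤ η₀ := sourceTailMass_mono hh hKI.1
  have hK2 : (K : ℝ) ^ 2 ≤ ((L : ℝ) + N) ^ 2 := by
    have h1 : (K : ℝ) < (L : ℝ) + N := by exact_mod_cast hKI.2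
    have h2 : (0 : ℝ) ≤ K := by exact_mod_cast hK0
    nlinarith
  have hπ := Real.pi_pos
  have hNpos : (0 : ℝ) < N := by exact_mod_cast hN
  -- B ≤ B₂ (linear bookkeeping)
  have s1 : 4 * Real.pi * S.card * M * L * G ≤ 4 * Real.pi * S.card * M * L * (2 * R * V / N) :=
    mul_le_mul_of_nonneg_left hK (by positivity)
  have s2 : 8 * Real.pi ^ 2 * ν * ((K : ℝ) ^ 2 + (L : ℝ) ^ 2) * V ≤
      8 * Real.pi ^ 2 * ν * (((L : ℝ) + N) ^ 2 + (L : ℝ) ^ 2) * V := by gcongr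
  have s3 : 2 * sourceTailMass K L h * W ≤ 2 * η₀ * ((T + V) / 2) :=
    mul_le_mul (by linarith) hW' hW0 (by positivity)
  have hB2 : 2 * ν * I.toReal ≤ scalarL2Sq θ₀ + 8 * Real.pi ^ 2 * ν * (((L : ℝ) + N) ^ 2 + (L : ℝ) ^ 2) * V +
      4 * Real.pi * S.card * M * L * (2 * R * V / N) + η₀ * (T + V) := by
    have : B ≤ scalarL2Sq θ₀ + 8 * Real.pi ^ 2 * ν * (((L : ℝ) + N) ^ 2 + (L : ℝ) ^ 2) * V +
        4 * Real.pi * S.card * M * L * (2 * R * V / N) + η₀ * (T + V) := by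
      rw [hB]; linarith
    exact hreal.trans this
  -- time means
  have htm : timeMean (fun t => ν * (eScalarGradNormSq (θ t)).toReal) T = T⁻¹ * (ν * I.toReal) :=
    timeMean_diss_eq hw hT hIfin
  have htmV : timeMean (fun t => scalarL2Sq (θ t)) T = T⁻¹ * V := by
    rw [timeMean, intervalIntegral.integral_of_le hT.le, integral_Ioc_eq_integral_Ioo]
  rw [htm, htmV]
  have hTi : 0 < T⁻¹ := inv_pos.2 hT
  have e2 : T⁻¹ * ((scalarL2Sq θ₀ + 8 * Real.pi ^ 2 * ν * (((L : ℝ) + N) ^ 2 + (L : ℝ) ^ 2) * V +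
      4 * Real.pi * S.card * M * L * (2 * R * V / N) + η₀ * (T + V)) / 2) =
      scalarL2Sq θ₀ / (2 * T) +
        (4 * Real.pi ^ 2 * ν * (((L : ℝ) + N) ^ 2 + (L : ℝ) ^ 2) + 4 * Real.pi * R * S.card * M * L / N +
          η₀ / 2) * (T⁻¹ * V) + η₀ / 2 := by
    field_simp
    ring
  calc T⁻¹ * (ν * I.toReal) ≤ T⁻¹ * ((scalarL2Sq θ₀ + 8 * Real.pi ^ 2 * ν * (((L : ℝ) + N) ^ 2 + (L : ℝ) ^ 2) * V +
      4 * Real.pi * S.card * M * L * (2 * R * V / N) + η₀ * (T + V)) / 2) :=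
        mul_le_mul_of_nonneg_left (by linarith) hTi.le
    _ = _ := e2

/-- **NO-GO THEOREM (shear–drift stirring).**  See the file docstring. [folklore] -/
theorem shearDrift_not_anomalous (hh : IsSmooth h) (hmean : HasZeroMean h)
    (hS : ∀ k ∈ S, k 1 = 0 ∧ |k 0| ≤ R) (hM0 : 0 ≤ M)
    {νs : ℕ → ℝ} (hν : ∀ j, 0 < νs j) (hν0 : Tendsto νs atTop (nhds 0))
    {cs : ℕ → ℝ → ℤ² → EuclideanSpace ℂ (Fin 2)} (hc : ∀ j k, Continuous fun s => cs j s k)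
    (hM : ∀ j s k, ‖cs j s k‖ ≤ M) (htrans : ∀ j s, ∀ k ∈ S, zdot k (cs j s k) = 0)
    {us : ℕ → ℝ → UnitAddTorus (Fin 2) → EuclideanSpace ℝ (Fin 2)} (hu : ∀ j s, us j s = realTrigPoly S (cs j s))
    {θ₀s : ℕ → UnitAddTorus (Fin 2) → ℝ} (hθ₀ : ∀ j, MemLp (θ₀s j) 2 volume)
    {θs : ℕ → ℝ → UnitAddTorus (Fin 2) → ℝ}
    (hweak : ∀ j, IsWeakScalarTransportForced (νs j) (us j) (fun _ => h) (θ₀s j) (θs j))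
    {E : ℝ} (hV : ∀ j, longTimeAvgSup (fun t => scalarL2Sq (θs j t)) ≤ E) :
    ¬ ∃ ε : ℝ, 0 < ε ∧ ∀ j, ε ≤ longTimeAvgSup (fun t => νs j * (eScalarGradNormSq (θs j t)).toReal) := by
  rintro ⟨ε, hε, hfl⟩
  have hh2 : MemLp h 2 volume := hh.memLp 2
  have hhi : Integrable h volume := hh.integrable
  set E' : ℝ := max E 0 + 1 with hE'
  have hE'1 : 1 ≤ E' := by rw [hE']; have := le_max_right E 0; linarith
  have hE'0 : 0 < E' := by linarith
  have hπ := Real.pi_pos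
  -- (1) the tail cut-off `L`
  obtain ⟨L, hL⟩ := sourceTailMass_small hh2 (η := ε / (4 * (1 + E'))) (by positivity)
  set η₀ := sourceTailMass L L h with hη₀
  have hη₀0 : 0 ≤ η₀ := sourceTailMass_nonneg _ _ _
  -- (2) the pigeonhole length `N`
  set A : ℝ := 4 * Real.pi * R * S.card * M * L * E' with hA
  have hA0 : 0 ≤ A := by positivity
  obtain ⟨N, hN⟩ := exists_nat_gt (max 1 (8 * A / ε))
  have hN1r : (1 : ℝ) < N := lt_of_le_of_lt (le_max_left _ _) hN
  have hN1 : 1 ≤ N := by exact_mod_cast hN1r.le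
  have hNpos : (0 : ℝ) < N := by linarith
  have hAN : A / N ≤ ε / 8 := by
    rw [div_le_iff₀ hNpos]
    have : 8 * A / ε < N := lt_of_le_of_lt (le_max_right _ _) hN
    rw [div_lt_iff₀ hε] at this
    linarith
  -- (3) the index `j`: `ν_j` small
  set Bc : ℝ := 4 * Real.pi ^ 2 * (((L : ℝ) + N) ^ 2 + (L : ℝ) ^ 2) * E' with hBc
  have hBc0 : 0 < Bc := by positivity
  obtain ⟨j, hj⟩ := ((tendsto_order.1 hν0).2 (ε / 8 / Bc) (by positivity)).exists
  set ν := νs j with hνdef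
  have hνpos : 0 < ν := hν j
  have hνB : 4 * Real.pi ^ 2 * ν * (((L : ℝ) + N) ^ 2 + (L : ℝ) ^ 2) * E' ≤ ε / 8 := by
    have : ν < ε / 8 / Bc := hj
    rw [lt_div_iff₀ hBc0] at this
    rw [show 4 * Real.pi ^ 2 * ν * (((L : ℝ) + N) ^ 2 + (L : ℝ) ^ 2) * E' = ν * Bc by rw [hBc]; ring]
    exact this.le
  -- (4) honesty of the variance of `θ_j`
  have hw := hweak j
  have hfin : ∀ T, 0 < T → ∫⁻ t in Ioo 0 T, eScalarGradNormSq (θs j t) ≠ ⊤ := by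
    intro T hT htop
    have hper := perT_dissipation_le hw hνpos.le (hu j) hh2 (hθ₀ j) (hc j) (hM j) hM0 (htrans j) hS
      (K := 0) (K₂ := 0) le_rfl hT
    rw [htop, ENNReal.mul_top (by simpa using hνpos)] at hper
    exact ENNReal.ofReal_ne_top (top_le_iff.1 hper)
  have hδ : 0 < E' - E := by rw [hE']; have := le_max_left E 0; linarith
  have hhon := honest_variance hw hνpos hhi hmean ((hθ₀ j).integrable one_le_two) hfin hε (hfl j) (hV j) hδ
  rw [show E + (E' - E) = E' by ring] at hhon
  -- (5) eventually the dissipation mean is ≤ ε/2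
  have hev : ∀ᶠ T in atTop, timeMean (fun t => ν * (eScalarGradNormSq (θs j t)).toReal) T ≤ ε / 2 := by
    filter_upwards [hhon, eventually_gt_atTop (0 : ℝ), eventually_ge_atTop (4 * scalarL2Sq (θ₀s j) / ε)]
      with T hVT hT0 hTθ
    have hest := timeMean_diss_le hνpos hw (hu j) hh2 (hθ₀ j) (hc j) (hM j) hM0 (htrans j) hS L hN1 hT0
    have hVT0 : 0 ≤ timeMean (fun t => scalarL2Sq (θs j t)) T := timeMean_nonneg (fun t => scalarL2Sq_nonneg _) hT0.le
    have h1 : scalarL2Sq (θ₀s j) / (2 * T) ≤ ε / 8 := by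
      rw [div_le_iff₀ (by positivity)]
      have hTθ' : 4 * scalarL2Sq (θ₀s j) / ε ≤ T := hTθ
      rw [div_le_iff₀ hε] at hTθ'
      nlinarith [scalarL2Sq_nonneg (θ₀s j)]
    have h2 : (4 * Real.pi ^ 2 * ν * (((L : ℝ) + N) ^ 2 + (L : ℝ) ^ 2)) * timeMean (fun t => scalarL2Sq (θs j t)) T ≤ ε / 8 := by
      calc _ ≤ (4 * Real.pi ^ 2 * ν * (((L : ℝ) + N) ^ 2 + (L : ℝ) ^ 2)) * E' := by gcongr
        _ ≤ ε / 8 := hνB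
    have h3 : (4 * Real.pi * R * S.card * M * L / N) * timeMean (fun t => scalarL2Sq (θs j t)) T ≤ ε / 8 := by
      calc _ ≤ (4 * Real.pi * R * S.card * M * L / N) * E' := by gcongr
        _ = A / N := by rw [hA]; ring
        _ ≤ ε / 8 := hAN
    have h4 : η₀ / 2 * timeMean (fun t => scalarL2Sq (θs j t)) T + η₀ / 2 ≤ ε / 8 := by
      have hη' : η₀ ≤ ε / (4 * (1 + E')) := hL
      calc η₀ / 2 * timeMean (fun t => scalarL2Sq (θs j t)) T + η₀ / 2 ≤ η₀ / 2 * E' + η₀ / 2 := by gcongr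
        _ = η₀ * ((1 + E') / 2) := by ring
        _ ≤ ε / (4 * (1 + E')) * ((1 + E') / 2) := by gcongr
        _ = ε / 8 := by field_simp; ring
    calc timeMean (fun t => ν * (eScalarGradNormSq (θs j t)).toReal) T
        ≤ scalarL2Sq (θ₀s j) / (2 * T) +
          (4 * Real.pi ^ 2 * ν * (((L : ℝ) + N) ^ 2 + (L : ℝ) ^ 2) + 4 * Real.pi * R * S.card * M * L / N +
            η₀ / 2) * timeMean (fun t => scalarL2Sq (θs j t)) T + η₀ / 2 := hest
      _ ≤ ε / 8 + (ε / 8 + ε / 8) + ε / 8 := by nlinarith [h1, h2, h3, h4]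
      _ = ε / 2 := by ring
  -- (6) but frequently it is ≥ 3ε/4
  have hfreq := frequently_le_timeMean_of_le_longTimeAvgSup hε (by positivity : (0 : ℝ) < ε / 4) (hfl j)
  obtain ⟨T, hT1, hT2⟩ := (hfreq.and_eventually hev).exists
  linarith

/-- **REFUTED STRENGTHENING: no witness of the crux is stirred by band-limited parallel shear flows
with uniform drift** (in particular not by the Galilean-swept Marchioro states). [folklore] -/
theorem not_cruxShearDrift (S : Finset ℤ²) (R : ℕ) (M : ℝ) (hS : ∀ k ∈ S, k 1 = 0 ∧ |k 0| ≤ R) (hM0 : 0 ≤ M) :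
    ¬ ∃ (g : UnitAddTorus (Fin 2) → EuclideanSpace ℝ (Fin 2)) (h : UnitAddTorus (Fin 2) → ℝ), IsAdmissible g h ∧
      ∃ (ν : ℕ → ℝ) (cs : ℕ → ℝ → ℤ² → EuclideanSpace ℂ (Fin 2))
        (v : ℕ → ℝ → UnitAddTorus (Fin 2) → EuclideanSpace ℝ (Fin 2))
        (θ₀ : ℕ → UnitAddTorus (Fin 2) → ℝ) (θ : ℕ → ℝ → UnitAddTorus (Fin 2) → ℝ),
        (∀ j, 0 < ν j) ∧ Tendsto ν atTop (nhds 0) ∧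
        (∀ j k, Continuous fun s => cs j s k) ∧ (∀ j s k, ‖cs j s k‖ ≤ M) ∧
        (∀ j s, ∀ k ∈ S, zdot k (cs j s k) = 0) ∧ (∀ j s, v j s = realTrigPoly S (cs j s)) ∧
        (∀ j, MemLp (θ₀ j) 2 volume) ∧
        (∀ j, IsWeakScalarTransportForced (ν j) (v j) (fun _ => h) (θ₀ j) (θ j)) ∧
        VarianceBounded θ ∧ Anomalous ν θ := by
  rintro ⟨g, h, hadm, ν, cs, v, θ₀, θ, hν, hν0, hc, hM, htrans, hu, hθ₀, hweak, ⟨E, hE⟩, hA⟩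
  exact shearDrift_not_anomalous hadm.smooth_h hadm.zeroMean_h hS hM0 hν hν0 hc hM htrans hu hθ₀ hweak hE hA

/-- The same through the clause bundle of `Negative.KillShape`: a candidate family of the crux
whose flows are band-limited parallel shear flows with uniform drift, with bounded scalar variance,
is never anomalous. [folklore] -/
theorem not_anomalous_of_isCandidate_shearDrift {S : Finset ℤ²} {R : ℕ} {M : ℝ}
    (hS : ∀ k ∈ S, k 1 = 0 ∧ |k 0| ≤ R) (hM0 : 0 ≤ M)
    {g : UnitAddTorus (Fin 2) → EuclideanSpace ℝ (Fin 2)} {h : UnitAddTorus (Fin 2) → ℝ} (hadm : IsAdmissible g h)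
    {ν : ℕ → ℝ} {v₀ : ℕ → UnitAddTorus (Fin 2) → EuclideanSpace ℝ (Fin 2)}
    {v : ℕ → ℝ → UnitAddTorus (Fin 2) → EuclideanSpace ℝ (Fin 2)}
    {cs : ℕ → ℝ → ℤ² → EuclideanSpace ℂ (Fin 2)} (hc : ∀ j k, Continuous fun s => cs j s k)
    (hM : ∀ j s k, ‖cs j s k‖ ≤ M) (htrans : ∀ j s, ∀ k ∈ S, zdot k (cs j s k) = 0)
    (hu : ∀ j s, v j s = realTrigPoly S (cs j s))
    {θ₀ : ℕ → UnitAddTorus (Fin 2) → ℝ} {θ : ℕ → ℝ → UnitAddTorus (Fin 2) → ℝ}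
    (hcand : IsCandidate g h ν v₀ v θ₀ θ) (hV : VarianceBounded θ) : ¬ Anomalous ν θ := by
  obtain ⟨E, hE⟩ := hV
  exact shearDrift_not_anomalous hadm.smooth_h hadm.zeroMean_h hS hM0 hcand.pos hcand.tendsto hc hM htrans hu
    hcand.memLp hcand.weak hE

end NoGo

end Summit.AnomalousDissipation.AnomalousDissipation.Theorems.ScalarAnomalySteadySourceFormal.Negative
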